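import Summits.HodgeConjecture.CorCM.PointwiseConjugationSlotsConverse
import Summits.HodgeConjecture.CorCM.PairwiseCMFamiliesHodge
import Literature.NumberTheory.ComplexMultiplication.PartialConjugationOfOneConjugate
import HarnessLib

/-!
# Pointwise partial conjugations for CM fields: rank additivity, the Hodge conjecture on every `∏_i A_i^{k_i}`, and
# the sharpness of the criterion

COR-CM (cell `pub-hodgecm2`, binder seat `b16` gen 48, count-neutral claim PTCONJ, file F2 — number fields; theorems
only, no definition, no named fact, no `sorry`).  NEW as stated, hence under `Summits/`.  HONEST FRAMING: the Hodge
conjecture for NAMED classes of CM abelian varieties (products of realisations of nondegenerate CM types whose fields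
satisfy an explicit Galois condition); `HC_CM` is neither used nor asserted.

The tree decides the stable nondegeneracy of `∏_i A_i` (realisations of CM types `(K_i; Φ_i)`) through the pairwise
"no common constituent" criterion (`PairwiseCMFamiliesHodge.isNondegenerateFamily_iff_forall_of_pairwise`); its Galois
menu for a pair of fields `(K_a, K_b)` was, in increasing strength: linearly disjoint Galois closures ⊂ Galois closures
meeting in a totally real field (`RealIntersectionCMFieldsHodge`) ⊂ ONE CONJUGATE: complex conjugation fixes
`L_a ∩ y₀(K_b)` for one embedding `y₀` (`GaloisClosureMeetsOneConjugateHodge`, i.e. some `σ ∈ Aut(ℂ)` is conjugation on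
ALL of `Hom(K_a, ℂ)` and fixes `y₀`).  The abstract files `PointwiseConjugationSlots[Converse]` (this seat) show that the
EXACT condition is POINTWISE:

> (PC) for every pair of embeddings `x : K_a → ℂ`, `y : K_b → ℂ` some `σ ∈ Aut(ℂ)` (depending on the pair) has
> `σ ∘ x = x̄` and `σ ∘ y = y` — complex conjugation on the ONE conjugate `x(K_a)` extends to an automorphism of `ℂ`
> over the ONE conjugate `y(K_b)`; by transitivity it suffices to check one `y = y₀` (`pointwiseConj_of_basePoint`),
> and (PC) is symmetric in `a, b`.

* §0 **`pairwise_of_pointwiseConj`**, **`pairwise_of_pointwiseConj_basePoint`** — (PC) ⟹ no common constituent for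
  `(a, b)` and `(b, a)`, for ALL CM types; `pointwiseConj_of_oneConjugate` — the one-conjugate hypothesis implies (PC)
  (so `GaloisClosureMeetsOneConjugateHodge`, `RealIntersectionCMFieldsHodge`, `LinearlyDisjointCMFieldsHodge` are
  contained).
* §1 **`isNondegenerateFamily_iff_of_forall_pointwiseConj`** (under (PC) for every pair, `(Φ_i)_i` is nondegenerate iff
  every member is), `cmFamilyRank_add_card_eq_of_forall_pointwiseConj` (`Hg(∏ A_i) = ∏ Hg(A_i)`), and the two-slot forms
  `isNondegenerateFamily_iff_pair_of_pointwiseConj`, `cmFamilyRank_add_card_eq_pair_of_pointwiseConj`.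
* §2 **`hodgeConjectureFor_prod_of_forall_pointwiseConj`**, **`hodgeConjectureFor_prod_pair_of_pointwiseConj`** — for
  realisations of NONDEGENERATE types of fields with (PC): the Hodge conjecture and `B• = D•` on EVERY `∏_i A_i^{k_i}`,
  UNCONDITIONALLY (no named fact).
* §3 SHARPNESS **`not_pairwise_of_not_pointwiseConj`**, **`pairwise_iff_pointwiseConj`** — for NONDEGENERATE `Φ_a`,
  `Φ_b` the pairwise hypothesis holds iff (PC) holds: when some pair `(x₀, y₀)` has no `σ`, the orbit operator of
  `(x₀, y₀)` is a common constituent of `U(Φ_a) = Anti`, `U(Φ_b) = Anti`.  (Additivity of the pair may then still hold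
  through the position of the type vectors — the reflex pairs of non-Galois quartic CM fields, `DihedralReflexPairCMHodge`,
  are additive for every type although `k₄ · (k₄')⁺ ⊇ k₄'` violates (PC).)

The field-theoretic reading of (PC) — `y₀(K_b) ⊄ x(K_a) · y₀(K_b⁺)` for every `x`, i.e. `K_a ⊗ K_b` and `K_a ⊗ K_b⁺`
have the same number of simple factors — is the sequel `PointwiseConjugationCompositum`.

## References

* [Gordon1999HodgeAVSurvey] B. B. Gordon, *A survey of the Hodge conjecture for abelian varieties*, §3 Theorem (Imai,
  Murty) with proof; 7.5–7.7; 10.10.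
* [MoonenZarhin1999LowDim] B. Moonen, Yu. Zarhin, *Hodge classes on abelian varieties of low dimension*, Math. Ann.
  315 (1999), Thm. (0.2) (4), Cor. (3.9).
* [Serre1977] J.-P. Serre, *Linear Representations of Finite Groups*, GTM 42, §7.3–7.4.
* [Lang2002] S. Lang, *Algebra*, GTM 211, VI §1 Thm. 1.12.
-/

noncomputable section

open CategoryTheory CategoryTheory.Limits NumberField NumberField.ComplexEmbedding IntermediateField
open scoped BigOperators

namespace Summit.HodgeConjecture.CorCM

open Literature.NumberTheory.ComplexMultiplication
open Literature.AlgebraicGeometry.Motives (AbelianVariety CMType)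
open Literature.AlgebraicGeometry.HodgeTheory
open Literature.AlgebraicGeometry.ComplexMultiplication (IsCMTypeRealisation)
open Literature.AlgebraicGeometry.VanGeemen1994 (hodgeClassSpan)
open Literature.AlgebraicGeometry.Pohlmann1968
open Literature.Barriers.HodgeConjecture (divisorClassesSpan)

/-! ## §0 Pointwise partial conjugations exclude common constituents -/

section Fields

variable {I : Type} {K : I → Type} [∀ i, Field (K i)] [∀ i, NumberField (K i)] [∀ i, IsCMField (K i)]

/-- On `Hom(K, ℂ)`, `K` a CM field, complex conjugation commutes with every automorphism of `ℂ`
("`z^{ασ} = z^{σρ}`"). [cite: Shimura1998, §18.2 Lemma (i)] -/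
private theorem smul_conj_smul_comm {a : I} (g : ℂ ≃+* ℂ) (s : K a →+* ℂ) :
    g • (starRingAut : ℂ ≃+* ℂ) • s = (starRingAut : ℂ ≃+* ℂ) • g • s := by
  refine RingHom.ext fun x => ?_
  change g (starRingEnd ℂ (s x)) = starRingEnd ℂ (g (s x))
  rw [← IsCMField.complexEmbedding_complexConj (K a) s x]
  exact IsCMField.complexEmbedding_complexConj (K a) ((g : ℂ →+* ℂ).comp s) x

omit [∀ i, NumberField (K i)] [∀ i, IsCMField (K i)] in
/-- Complex conjugation is an involution on `Hom(K, ℂ)`. [folklore] -/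
private theorem conj_smul_conj_smul {a : I} (s : K a →+* ℂ) :
    (starRingAut : ℂ ≃+* ℂ) • (starRingAut : ℂ ≃+* ℂ) • s = s := by
  rw [conj_smul_eq_conjugate, conj_smul_eq_conjugate]
  exact ComplexEmbedding.involutive_conjugate (K a) s

/-- **(PC) from one base point is (PC)**: if every `x : K_a → ℂ` admits `σ ∈ Aut(ℂ)` with `σ ∘ x = x̄` and
`σ ∘ y₀ = y₀`, then every pair `(x, y)` admits such a `σ` (`Aut(ℂ)` is transitive on `Hom(K_b, ℂ)`).
[cite: Lang2002, V §2 Thm. 2.8] -/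
theorem pointwiseConj_of_basePoint {a b : I} (y₀ : K b →+* ℂ)
    (hpt : ∀ x : K a →+* ℂ, ∃ σ : ℂ ≃+* ℂ, σ • x = (starRingAut : ℂ ≃+* ℂ) • x ∧ σ • y₀ = y₀) :
    ∀ (x : K a →+* ℂ) (y : K b →+* ℂ), ∃ σ : ℂ ≃+* ℂ, σ • x = (starRingAut : ℂ ≃+* ℂ) • x ∧ σ • y = y :=
  haveI := isPretransitive_ringEquiv_complex (K := K b)
  PointwiseConj.pointwiseConj_of_basePoint (fun g x => smul_conj_smul_comm (a := a) g x)
    (fun y => MulAction.exists_smul_eq (ℂ ≃+* ℂ) y₀ y) hpt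

/-- **(PC) is symmetric**: from `σ ∘ x = x̄`, `σ ∘ y = y` for all pairs one gets `σ' ∘ y = ȳ`, `σ' ∘ x = x` for all
pairs (`σ' = conj ∘ σ⁻¹`). [cite: Serre1977, §7.3] -/
theorem pointwiseConj_symm {a b : I}
    (hpt : ∀ (x : K a →+* ℂ) (y : K b →+* ℂ), ∃ σ : ℂ ≃+* ℂ, σ • x = (starRingAut : ℂ ≃+* ℂ) • x ∧ σ • y = y) :
    ∀ (y : K b →+* ℂ) (x : K a →+* ℂ), ∃ σ : ℂ ≃+* ℂ, σ • y = (starRingAut : ℂ ≃+* ℂ) • y ∧ σ • x = x :=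
  PointwiseConj.pointwiseConj_symm (fun g x => smul_conj_smul_comm (a := a) g x) (fun x => conj_smul_conj_smul x) hpt

/-- **The one-conjugate hypothesis implies (PC)**: if conjugation fixes `L_a ∩ y₀(K_b)` pointwise, some `σ` is
conjugation on all of `Hom(K_a, ℂ)` and fixes `y₀`, and it serves every pair. [cite: Lang2002, VI §1 Thm. 1.12] -/
theorem pointwiseConj_of_oneConjugate {a b : I} (y₀ : K b →+* ℂ)
    (hreal : ∀ x : ℂ, x ∈ normalClosure ℚ (K a) ℂ → x ∈ y₀.toRatAlgHom.fieldRange → starRingEnd ℂ x = x) :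
    ∀ (x : K a →+* ℂ) (y : K b →+* ℂ), ∃ σ : ℂ ≃+* ℂ, σ • x = (starRingAut : ℂ ≃+* ℂ) • x ∧ σ • y = y := by
  obtain ⟨σ, hσa, hσb⟩ := exists_ringEquiv_conj_smul_and_smul_eq (k := K a) (K := K b) y₀ hreal
  exact pointwiseConj_of_basePoint y₀ fun x => ⟨σ, hσa x, hσb⟩

omit [∀ i, NumberField (K i)] [∀ i, IsCMField (K i)] in
/-- **A partial conjugation implies (PC)** (`σ` conjugation on `Hom(K_a, ℂ)`, identity on `Hom(K_b, ℂ)`).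
[cite: Gordon1999HodgeAVSurvey, §3 Theorem (proof)] -/
theorem pointwiseConj_of_partialConj {a b : I} {σ : ℂ ≃+* ℂ}
    (hσa : ∀ s : K a →+* ℂ, σ • s = (starRingAut : ℂ ≃+* ℂ) • s) (hσb : ∀ s : K b →+* ℂ, σ • s = s) :
    ∀ (x : K a →+* ℂ) (y : K b →+* ℂ), ∃ σ : ℂ ≃+* ℂ, σ • x = (starRingAut : ℂ ≃+* ℂ) • x ∧ σ • y = y :=
  fun x y => ⟨σ, hσa x, hσb y⟩

/-- **(PC) excludes common constituents, in both orders, for all CM types.**  If every pair of embeddings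
`x : K_a → ℂ`, `y : K_b → ℂ` admits `σ ∈ Aut(ℂ)` with `σ ∘ x = x̄` and `σ ∘ y = y`, then no non-zero `Aut(ℂ)`-stable
`P ≤ U(Φ_a)` maps equivariantly and injectively into `U(Φ_b)`, nor vice versa.
[cite: Gordon1999HodgeAVSurvey, §3 Theorem (proof)] [cite: Serre1977, §7.3–7.4] -/
theorem pairwise_of_pointwiseConj (Φ : ∀ i, CMType (K i)) {a b : I}
    (hpt : ∀ (x : K a →+* ℂ) (y : K b →+* ℂ), ∃ σ : ℂ ≃+* ℂ, σ • x = (starRingAut : ℂ ≃+* ℂ) • x ∧ σ • y = y) :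
    (∀ P : Submodule ℚ ((K a →+* ℂ) → ℚ), P ≤ antiSpan (ℂ ≃+* ℂ) (Φ a).1 →
      (∀ g : ℂ ≃+* ℂ, ∀ f ∈ P, (fun x => f (g • x)) ∈ P) →
      ∀ T : ((K a →+* ℂ) → ℚ) →ₗ[ℚ] ((K b →+* ℂ) → ℚ),
        (∀ g : ℂ ≃+* ℂ, ∀ f ∈ P, T (fun x => f (g • x)) = fun y => T f (g • y)) →
        (∀ f ∈ P, T f ∈ antiSpan (ℂ ≃+* ℂ) (Φ b).1) → (∀ f ∈ P, T f = 0 → f = 0) → P = ⊥) ∧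
    (∀ P : Submodule ℚ ((K b →+* ℂ) → ℚ), P ≤ antiSpan (ℂ ≃+* ℂ) (Φ b).1 →
      (∀ g : ℂ ≃+* ℂ, ∀ f ∈ P, (fun x => f (g • x)) ∈ P) →
      ∀ T : ((K b →+* ℂ) → ℚ) →ₗ[ℚ] ((K a →+* ℂ) → ℚ),
        (∀ g : ℂ ≃+* ℂ, ∀ f ∈ P, T (fun x => f (g • x)) = fun y => T f (g • y)) →
        (∀ f ∈ P, T f ∈ antiSpan (ℂ ≃+* ℂ) (Φ a).1) → (∀ f ∈ P, T f = 0 → f = 0) → P = ⊥) := by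
  classical
  exact PointwiseConj.pairwise_of_pointwiseConj (G := ℂ ≃+* ℂ) (Φ := fun i => (Φ i).1)
    (fun i => isCMTypeWith_conj (Φ i)) hpt

/-- **(PC) from one base point excludes common constituents** (both orders, all types).
[cite: Gordon1999HodgeAVSurvey, §3 Theorem (proof)] [cite: Serre1977, §7.3–7.4] -/
theorem pairwise_of_pointwiseConj_basePoint (Φ : ∀ i, CMType (K i)) {a b : I} (y₀ : K b →+* ℂ)
    (hpt : ∀ x : K a →+* ℂ, ∃ σ : ℂ ≃+* ℂ, σ • x = (starRingAut : ℂ ≃+* ℂ) • x ∧ σ • y₀ = y₀) :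
    (∀ P : Submodule ℚ ((K a →+* ℂ) → ℚ), P ≤ antiSpan (ℂ ≃+* ℂ) (Φ a).1 →
      (∀ g : ℂ ≃+* ℂ, ∀ f ∈ P, (fun x => f (g • x)) ∈ P) →
      ∀ T : ((K a →+* ℂ) → ℚ) →ₗ[ℚ] ((K b →+* ℂ) → ℚ),
        (∀ g : ℂ ≃+* ℂ, ∀ f ∈ P, T (fun x => f (g • x)) = fun y => T f (g • y)) →
        (∀ f ∈ P, T f ∈ antiSpan (ℂ ≃+* ℂ) (Φ b).1) → (∀ f ∈ P, T f = 0 → f = 0) → P = ⊥) ∧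
    (∀ P : Submodule ℚ ((K b →+* ℂ) → ℚ), P ≤ antiSpan (ℂ ≃+* ℂ) (Φ b).1 →
      (∀ g : ℂ ≃+* ℂ, ∀ f ∈ P, (fun x => f (g • x)) ∈ P) →
      ∀ T : ((K b →+* ℂ) → ℚ) →ₗ[ℚ] ((K a →+* ℂ) → ℚ),
        (∀ g : ℂ ≃+* ℂ, ∀ f ∈ P, T (fun x => f (g • x)) = fun y => T f (g • y)) →
        (∀ f ∈ P, T f ∈ antiSpan (ℂ ≃+* ℂ) (Φ a).1) → (∀ f ∈ P, T f = 0 → f = 0) → P = ⊥) :=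
  pairwise_of_pointwiseConj Φ (pointwiseConj_of_basePoint y₀ hpt)

end Fields

/-! ## §1 Rank additivity and the nondegeneracy criterion -/

section Rank

variable {I : Type} {K : I → Type} [∀ i, Field (K i)] [∀ i, NumberField (K i)] [∀ i, IsCMField (K i)] [Fintype I]
  [DecidableEq I]

omit [Fintype I] [DecidableEq I] in
/-- **The pairwise criterion from (PC) on every pair of slots.** [cite: Gordon1999HodgeAVSurvey, §3 Theorem (proof)] -/
theorem pairwise_of_forall_pointwiseConj (Φ : ∀ i, CMType (K i))
    (h : ∀ i j, i ≠ j → ∀ (x : K i →+* ℂ) (y : K j →+* ℂ),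
      ∃ σ : ℂ ≃+* ℂ, σ • x = (starRingAut : ℂ ≃+* ℂ) • x ∧ σ • y = y) :
    ∀ i j, i ≠ j → ∀ P : Submodule ℚ ((K i →+* ℂ) → ℚ), P ≤ antiSpan (ℂ ≃+* ℂ) (Φ i).1 →
      (∀ g : ℂ ≃+* ℂ, ∀ f ∈ P, (fun x => f (g • x)) ∈ P) →
      ∀ T : ((K i →+* ℂ) → ℚ) →ₗ[ℚ] ((K j →+* ℂ) → ℚ),
        (∀ g : ℂ ≃+* ℂ, ∀ f ∈ P, T (fun x => f (g • x)) = fun y => T f (g • y)) →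
        (∀ f ∈ P, T f ∈ antiSpan (ℂ ≃+* ℂ) (Φ j).1) → (∀ f ∈ P, T f = 0 → f = 0) → P = ⊥ :=
  fun i j hij => (pairwise_of_pointwiseConj Φ (h i j hij)).1

omit [Fintype I] [DecidableEq I] in
/-- **The pairwise criterion from (PC) on every UNORDERED pair** (one order per pair suffices, (PC) being symmetric):
here from a family of base points `y₀ i j : K_j → ℂ` with (PC) at `y₀ i j` whenever `i < j` for some relation deciding
every pair. [cite: Gordon1999HodgeAVSurvey, §3 Theorem (proof)] -/
theorem pairwise_of_forall_pointwiseConj_or (Φ : ∀ i, CMType (K i))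
    (h : ∀ i j, i ≠ j →
      (∀ (x : K i →+* ℂ) (y : K j →+* ℂ), ∃ σ : ℂ ≃+* ℂ, σ • x = (starRingAut : ℂ ≃+* ℂ) • x ∧ σ • y = y) ∨
      (∀ (y : K j →+* ℂ) (x : K i →+* ℂ), ∃ σ : ℂ ≃+* ℂ, σ • y = (starRingAut : ℂ ≃+* ℂ) • y ∧ σ • x = x)) :
    ∀ i j, i ≠ j → ∀ P : Submodule ℚ ((K i →+* ℂ) → ℚ), P ≤ antiSpan (ℂ ≃+* ℂ) (Φ i).1 →
      (∀ g : ℂ ≃+* ℂ, ∀ f ∈ P, (fun x => f (g • x)) ∈ P) →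
      ∀ T : ((K i →+* ℂ) → ℚ) →ₗ[ℚ] ((K j →+* ℂ) → ℚ),
        (∀ g : ℂ ≃+* ℂ, ∀ f ∈ P, T (fun x => f (g • x)) = fun y => T f (g • y)) →
        (∀ f ∈ P, T f ∈ antiSpan (ℂ ≃+* ℂ) (Φ j).1) → (∀ f ∈ P, T f = 0 → f = 0) → P = ⊥ := by
  intro i j hij
  rcases h i j hij with h₁ | h₂
  · exact (pairwise_of_pointwiseConj Φ h₁).1
  · exact (pairwise_of_pointwiseConj Φ (a := j) (b := i) h₂).2

/-- **Nondegeneracy criterion under (PC) on every pair**: `(Φ_i)_i` is nondegenerate iff every `Φ_i` is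
(`∏_i A_i` stably nondegenerate iff every factor is). [cite: Gordon1999HodgeAVSurvey, §3 Theorem and 7.5] -/
theorem isNondegenerateFamily_iff_of_forall_pointwiseConj [Nonempty I] (Φ : ∀ i, CMType (K i))
    (h : ∀ i j, i ≠ j → ∀ (x : K i →+* ℂ) (y : K j →+* ℂ),
      ∃ σ : ℂ ≃+* ℂ, σ • x = (starRingAut : ℂ ≃+* ℂ) • x ∧ σ • y = y) :
    CMAlgebra.IsNondegenerateFamily Φ ↔ ∀ i, IsNondegenerate (Φ i) :=
  isNondegenerateFamily_iff_forall_of_pairwise Φ (pairwise_of_forall_pointwiseConj Φ h)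

/-- **Rank additivity under (PC) on every pair**: `rank((Φ_i)_i) + |I| = Σ_i rank(Φ_i) + 1`
(`Hg(∏_i A_i) = ∏_i Hg(A_i)`), for ALL CM types. [cite: Gordon1999HodgeAVSurvey, §3 Theorem (1)] -/
theorem cmFamilyRank_add_card_eq_of_forall_pointwiseConj [Nonempty I] (Φ : ∀ i, CMType (K i))
    (h : ∀ i j, i ≠ j → ∀ (x : K i →+* ℂ) (y : K j →+* ℂ),
      ∃ σ : ℂ ≃+* ℂ, σ • x = (starRingAut : ℂ ≃+* ℂ) • x ∧ σ • y = y) :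
    CMAlgebra.cmFamilyRank Φ + Fintype.card I = (∑ i, cmTypeRank (Φ i)) + 1 :=
  cmFamilyRank_add_card_eq_of_pairwise Φ (pairwise_of_forall_pointwiseConj Φ h)

/-- **Two slots under (PC) at one base point**: if every `x : K_{i₀} → ℂ` admits `σ` with `σ ∘ x = x̄`,
`σ ∘ y₀ = y₀`, the pair `(Φ_{i₀}, Φ_{i₁})` is nondegenerate iff both members are.
[cite: Gordon1999HodgeAVSurvey, §3 Theorem and 7.5] [cite: MoonenZarhin1999LowDim, Thm. (0.2) (4)] -/
theorem isNondegenerateFamily_iff_pair_of_pointwiseConj {i₀ i₁ : I} (h01 : i₀ ≠ i₁) (hI : ∀ j, j = i₀ ∨ j = i₁)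
    (Φ : ∀ i, CMType (K i)) (y₀ : K i₁ →+* ℂ)
    (hpt : ∀ x : K i₀ →+* ℂ, ∃ σ : ℂ ≃+* ℂ, σ • x = (starRingAut : ℂ ≃+* ℂ) • x ∧ σ • y₀ = y₀) :
    CMAlgebra.IsNondegenerateFamily Φ ↔ ∀ i, IsNondegenerate (Φ i) := by
  haveI : Nonempty I := ⟨i₀⟩
  have hpc := pointwiseConj_of_basePoint y₀ hpt
  refine isNondegenerateFamily_iff_forall_of_pairwise Φ (pairwise_of_forall_pointwiseConj_or Φ fun i j hij => ?_)
  rcases hI i with rfl | rfl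
  · rcases hI j with rfl | rfl
    · exact absurd rfl hij
    · exact Or.inl hpc
  · rcases hI j with rfl | rfl
    · exact Or.inr hpc
    · exact absurd rfl hij

/-- **Two slots under (PC): `rank(Φ_{i₀}, Φ_{i₁}) + 2 = rank(Φ_{i₀}) + rank(Φ_{i₁}) + 1`**
(`Hg(A₀ × A₁) = Hg(A₀) × Hg(A₁)`), for ALL CM types. [cite: Gordon1999HodgeAVSurvey, §3 Theorem (1)] -/
theorem cmFamilyRank_add_card_eq_pair_of_pointwiseConj {i₀ i₁ : I} (h01 : i₀ ≠ i₁) (hI : ∀ j, j = i₀ ∨ j = i₁)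
    (Φ : ∀ i, CMType (K i)) (y₀ : K i₁ →+* ℂ)
    (hpt : ∀ x : K i₀ →+* ℂ, ∃ σ : ℂ ≃+* ℂ, σ • x = (starRingAut : ℂ ≃+* ℂ) • x ∧ σ • y₀ = y₀) :
    CMAlgebra.cmFamilyRank Φ + Fintype.card I = (∑ i, cmTypeRank (Φ i)) + 1 := by
  haveI : Nonempty I := ⟨i₀⟩
  have hpc := pointwiseConj_of_basePoint y₀ hpt
  refine cmFamilyRank_add_card_eq_of_pairwise Φ (pairwise_of_forall_pointwiseConj_or Φ fun i j hij => ?_)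
  rcases hI i with rfl | rfl
  · rcases hI j with rfl | rfl
    · exact absurd rfl hij
    · exact Or.inl hpc
  · rcases hI j with rfl | rfl
    · exact Or.inr hpc
    · exact absurd rfl hij

end Rank

/-! ## §2 Geometry: the Hodge conjecture on every `∏_i A_i^{k_i}` -/

section Geometry

variable {I : Type} {K : I → Type} [∀ i, Field (K i)] [∀ i, NumberField (K i)] [∀ i, IsCMField (K i)] [Fintype I]
  [DecidableEq I] {Φ : ∀ i, CMType (K i)}
variable {A : I → AbelianVariety ℂ} {ι : ∀ i, 𝓞 (K i) →+* End (A i)}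
  {θ : ∀ i, K i →+* Module.End ℂ (complexBetti (A i).X 1)}

/-- **(PC) on every pair and nondegenerate members: the Hodge conjecture and `B• = D•` on EVERY `⨁_{j<N} A_{π j}`**
(every `∏_i A_i^{k_i}`), UNCONDITIONALLY, for realisations `(A_i, ι_i, θ_i)` of the `(K_i; Φ_i)`.
[cite: Gordon1999HodgeAVSurvey, §3 Theorem, 7.5 and 10.10] -/
theorem hodgeConjectureFor_prod_of_forall_pointwiseConj [Nonempty I]
    (h : ∀ i j, i ≠ j → ∀ (x : K i →+* ℂ) (y : K j →+* ℂ),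
      ∃ σ : ℂ ≃+* ℂ, σ • x = (starRingAut : ℂ ≃+* ℂ) • x ∧ σ • y = y)
    (hΦ : ∀ i, IsNondegenerate (Φ i)) (hA : ∀ i, IsCMTypeRealisation (Φ i) (A i) (ι i) (θ i)) {N : ℕ}
    (π : Fin N → I) :
    HodgeConjectureFor (⨁ fun j : Fin N => A (π j)).dim (⨁ fun j : Fin N => A (π j)).X ∧
      ∀ m : ℕ, hodgeClassSpan (⨁ fun j : Fin N => A (π j)).dim (⨁ fun j : Fin N => A (π j)).X m =
        divisorClassesSpan (⨁ fun j : Fin N => A (π j)).X (⨁ fun j : Fin N => A (π j)).dim m :=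
  have hnd := (isNondegenerateFamily_iff_of_forall_pointwiseConj Φ h).2 hΦ
  ⟨hnd.hodgeConjectureFor_prod hA π, fun m => hnd.hodgeClassSpan_prod_eq_divisorClassesSpan hA π m⟩

/-- **Two CM abelian varieties `A₀`, `A₁` of nondegenerate types whose fields satisfy (PC) at one base point**
(every `x : K_{i₀} → ℂ` has `σ ∈ Aut(ℂ)` with `σ ∘ x = x̄`, `σ ∘ y₀ = y₀`): the Hodge conjecture and `B• = D•` on EVERY
`A₀^a × A₁^b`, UNCONDITIONALLY. [cite: MoonenZarhin1999LowDim, Thm. (0.2) (4)]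
[cite: Gordon1999HodgeAVSurvey, §3 Theorem, 7.5 and 10.10] -/
theorem hodgeConjectureFor_prod_pair_of_pointwiseConj {i₀ i₁ : I} (h01 : i₀ ≠ i₁) (hI : ∀ j, j = i₀ ∨ j = i₁)
    (y₀ : K i₁ →+* ℂ)
    (hpt : ∀ x : K i₀ →+* ℂ, ∃ σ : ℂ ≃+* ℂ, σ • x = (starRingAut : ℂ ≃+* ℂ) • x ∧ σ • y₀ = y₀)
    (hΦ : ∀ i, IsNondegenerate (Φ i)) (hA : ∀ i, IsCMTypeRealisation (Φ i) (A i) (ι i) (θ i)) {N : ℕ}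
    (π : Fin N → I) :
    HodgeConjectureFor (⨁ fun j : Fin N => A (π j)).dim (⨁ fun j : Fin N => A (π j)).X ∧
      ∀ m : ℕ, hodgeClassSpan (⨁ fun j : Fin N => A (π j)).dim (⨁ fun j : Fin N => A (π j)).X m =
        divisorClassesSpan (⨁ fun j : Fin N => A (π j)).X (⨁ fun j : Fin N => A (π j)).dim m :=
  haveI : Nonempty I := ⟨i₀⟩
  have hnd := (isNondegenerateFamily_iff_pair_of_pointwiseConj h01 hI Φ y₀ hpt).2 hΦ
  ⟨hnd.hodgeConjectureFor_prod hA π, fun m => hnd.hodgeClassSpan_prod_eq_divisorClassesSpan hA π m⟩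

end Geometry

/-! ## §3 Sharpness: for nondegenerate types the pairwise criterion holds iff (PC) holds -/

section Sharpness

variable {I : Type} {K : I → Type} [∀ i, Field (K i)] [∀ i, NumberField (K i)] [∀ i, IsCMField (K i)]

/-- A nondegenerate CM type spans the odd weights: `U(Φ) = Anti`. [cite: Kubota1965, §2 (p. 115)] -/
theorem antiSpan_eq_antiWeights_of_isNondegenerate {i : I} {Φ : CMType (K i)} (hΦ : IsNondegenerate Φ) :
    antiSpan (ℂ ≃+* ℂ) Φ.1 = antiWeights (E := K i →+* ℂ) (starRingAut : ℂ ≃+* ℂ) := by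
  refine (isCMTypeWith_conj Φ).typeRank_eq_iff_antiSpan_eq.1 ?_
  rw [Embeddings.card]
  exact (isNondegenerate_iff Φ).1 hΦ

/-- **No pointwise conjugation at `(x₀, y₀)` and nondegenerate types ⟹ the pairwise hypothesis FAILS for `(a, b)`**:
the orbit operator of `(x₀, y₀)` carries a non-zero stable `P ≤ U(Φ_a) = Anti` equivariantly and injectively into
`U(Φ_b) = Anti`.  (The rank of the pair may still be additive — through the position of the type vectors.)
[cite: Serre1977, §7.3–7.4] [cite: Gordon1999HodgeAVSurvey, 7.5–7.7] -/
theorem not_pairwise_of_not_pointwiseConj (Φ : ∀ i, CMType (K i)) {a b : I} (ha : IsNondegenerate (Φ a))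
    (hb : IsNondegenerate (Φ b)) {x₀ : K a →+* ℂ} {y₀ : K b →+* ℂ}
    (hnot : ¬ ∃ σ : ℂ ≃+* ℂ, σ • x₀ = (starRingAut : ℂ ≃+* ℂ) • x₀ ∧ σ • y₀ = y₀) :
    ¬ ∀ P : Submodule ℚ ((K a →+* ℂ) → ℚ), P ≤ antiSpan (ℂ ≃+* ℂ) (Φ a).1 →
      (∀ g : ℂ ≃+* ℂ, ∀ f ∈ P, (fun x => f (g • x)) ∈ P) →
      ∀ T : ((K a →+* ℂ) → ℚ) →ₗ[ℚ] ((K b →+* ℂ) → ℚ),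
        (∀ g : ℂ ≃+* ℂ, ∀ f ∈ P, T (fun x => f (g • x)) = fun y => T f (g • y)) →
        (∀ f ∈ P, T f ∈ antiSpan (ℂ ≃+* ℂ) (Φ b).1) → (∀ f ∈ P, T f = 0 → f = 0) → P = ⊥ := by
  classical
  exact PointwiseConj.not_pairwise_of_not_pointwiseConj (G := ℂ ≃+* ℂ) (Φ := fun i => (Φ i).1)
    (fun i => isCMTypeWith_conj (Φ i)) (antiSpan_eq_antiWeights_of_isNondegenerate ha)
    (antiSpan_eq_antiWeights_of_isNondegenerate hb) hnot

/-- **The exact criterion for nondegenerate types.**  For `Φ_a`, `Φ_b` nondegenerate, the slots `a → b` have no common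
constituent (the hypothesis `hpair` of the pairwise criterion) **iff** (PC): every pair of embeddings
`x : K_a → ℂ`, `y : K_b → ℂ` admits `σ ∈ Aut(ℂ)` with `σ ∘ x = x̄` and `σ ∘ y = y`.
[cite: Serre1977, §7.3–7.4] [cite: Gordon1999HodgeAVSurvey, §3 Theorem and 7.5] -/
theorem pairwise_iff_pointwiseConj (Φ : ∀ i, CMType (K i)) {a b : I} (ha : IsNondegenerate (Φ a))
    (hb : IsNondegenerate (Φ b)) :
    (∀ P : Submodule ℚ ((K a →+* ℂ) → ℚ), P ≤ antiSpan (ℂ ≃+* ℂ) (Φ a).1 →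
      (∀ g : ℂ ≃+* ℂ, ∀ f ∈ P, (fun x => f (g • x)) ∈ P) →
      ∀ T : ((K a →+* ℂ) → ℚ) →ₗ[ℚ] ((K b →+* ℂ) → ℚ),
        (∀ g : ℂ ≃+* ℂ, ∀ f ∈ P, T (fun x => f (g • x)) = fun y => T f (g • y)) →
        (∀ f ∈ P, T f ∈ antiSpan (ℂ ≃+* ℂ) (Φ b).1) → (∀ f ∈ P, T f = 0 → f = 0) → P = ⊥) ↔
    ∀ (x : K a →+* ℂ) (y : K b →+* ℂ), ∃ σ : ℂ ≃+* ℂ, σ • x = (starRingAut : ℂ ≃+* ℂ) • x ∧ σ • y = y := by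
  classical
  exact PointwiseConj.pairwise_iff_pointwiseConj (G := ℂ ≃+* ℂ) (Φ := fun i => (Φ i).1)
    (fun i => isCMTypeWith_conj (Φ i)) (antiSpan_eq_antiWeights_of_isNondegenerate ha)
    (antiSpan_eq_antiWeights_of_isNondegenerate hb)

/-- **The exact criterion from one base point** (transitivity of `Aut(ℂ)` on `Hom(K_b, ℂ)`): for nondegenerate
`Φ_a`, `Φ_b` the slots have no common constituent iff every `x : K_a → ℂ` admits `σ` with `σ ∘ x = x̄`, `σ ∘ y₀ = y₀`.
[cite: Serre1977, §7.3–7.4] [cite: Gordon1999HodgeAVSurvey, §3 Theorem and 7.5] -/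
theorem pairwise_iff_pointwiseConj_basePoint (Φ : ∀ i, CMType (K i)) {a b : I} (ha : IsNondegenerate (Φ a))
    (hb : IsNondegenerate (Φ b)) (y₀ : K b →+* ℂ) :
    (∀ P : Submodule ℚ ((K a →+* ℂ) → ℚ), P ≤ antiSpan (ℂ ≃+* ℂ) (Φ a).1 →
      (∀ g : ℂ ≃+* ℂ, ∀ f ∈ P, (fun x => f (g • x)) ∈ P) →
      ∀ T : ((K a →+* ℂ) → ℚ) →ₗ[ℚ] ((K b →+* ℂ) → ℚ),
        (∀ g : ℂ ≃+* ℂ, ∀ f ∈ P, T (fun x => f (g • x)) = fun y => T f (g • y)) →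
        (∀ f ∈ P, T f ∈ antiSpan (ℂ ≃+* ℂ) (Φ b).1) → (∀ f ∈ P, T f = 0 → f = 0) → P = ⊥) ↔
    ∀ x : K a →+* ℂ, ∃ σ : ℂ ≃+* ℂ, σ • x = (starRingAut : ℂ ≃+* ℂ) • x ∧ σ • y₀ = y₀ := by
  rw [pairwise_iff_pointwiseConj Φ ha hb]
  exact ⟨fun h x => h x y₀, fun h => pointwiseConj_of_basePoint y₀ h⟩

end Sharpness

end Summit.HodgeConjecture.CorCM

end
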